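import Summits.QuantumFields.BalabanUV.T4Continuum.Support.VariationalTaxiNested

/-!
# T⁴ programme, spine node NE2 (U1a), road P2 supplier item (O10), part 2 — THE TOWER: the relative phase `‖T_k·conj (taxiT_k) − 1‖ ≤ γ`
# of ANY COMP⁺ tower of transports over coherent taxi data, k-UNIFORMLY, with `γ = γ₀ + 4d²·c` under the scale-invariant plaquette class

NE2 formalisation swarm, leaf prover 01 (gen 4); sequel of `Support/VariationalTaxiNested` (INTENT CLAIMS.log l.10863; interface as asked by
leaf-04-g3 l.11043 and the road owner t4-ne2-p2-g11 l.11061): for fine phases `R′ k : Tor (fine L (fine (L^k) M)) → Fin d → ℂ` (unit, plaquette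
defect `a k`, CLASS `(L^k·L)²·a k ≤ c`), COHERENT in the sense `coarseT L (fine (L^(k+1)) M) (R′ (k+1)) = Rtr (L^k) L M (R′ k)` (each level's
straight `L`-bond coarsening IS the previous level's phases), and ANY transports `T k : Tor (fine (L^k) M) → ℂ` with `|T k| = 1` and the COMP⁺
recursion `T (k+1) = compT (L^k) L M (T k) (taxiT L (fine (L^k) M) (R′ k))`, the R3 binder of `VariationalCovariantEndRel.towerLimitRate_scalarTower_closed_rel`
holds LITERALLY: **`tower_hrel`**: `∀ k x, ‖T k x · conj (taxiT (L^k) M (coarseT L (fine (L^k) M) (R′ k)) x) − 1‖ ≤ γ₀ + 4d²·c` (`γ₀` the level-0 line,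
`L ≥ 2`), through the sharper invariant `tower_hrel_geom` (`≤ γ₀ + 4d²c·(1 − L^{−k})`): the per-level step of part 1 (`norm_compT_rel_step`,
`step_le_of_class`: `≤ 2d²c/L^k`) is summed geometrically.  No `def` (the nested tower is the consumer's `T` with `hTcomp`; leaf-04-g3's (O7)
`nestT` or any other instance plugs in BY NAME).

HONEST FRAMING (T4-DAG p. 1).  Abelian lattice gauge bookkeeping about OUR typed taxi objects; model level (U(1), unit phases DATA); [folklore];
nothing printed is a hypothesis; no `def … : Prop`; no `sorry`.  It supplies the `hrel` INPUT of the owner's repaired END (R3 p215080) for coherent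
taxi data; by itself NOT an END, NOT NE2: NE2 NOT proved on either road; spine 0/9; rung (B)+1 finite T⁴ — NOT infinite volume, NOT mass gap, NOT
Clay.  HONEST DEPENDENCY: continuum YM on T⁴ ⇐ BetaPertH ∧ nine spine estimates (0/9 proved); BetaPertH ⇐ (D1) ∧ (D4) ∧ CAP+tail; G-an2-4 gates
asym, D1 and NE2/3/4.
-/

noncomputable section

open scoped BigOperators ComplexConjugate

namespace Summit.QuantumFields.BalabanUV.T4Continuum.VariationalTaxiNestedTower

open Literature.MathematicalPhysics.QuantumFieldTheory.Balaban1983to89.B5Prop11Plancherel (Tor fine)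
open Summit.QuantumFields.BalabanUV.T4Continuum.VariationalCovariantTower (compT Rtr)
open Summit.QuantumFields.BalabanUV.T4Continuum.VariationalTaxiTransport (plaq taxiT)
open Summit.QuantumFields.BalabanUV.T4Continuum.VariationalTaxiCoarse (coarseT)
open Summit.QuantumFields.BalabanUV.T4Continuum.VariationalTaxiNested (norm_compT_rel_step step_le_of_class)

variable {d : ℕ} (L : ℕ) [NeZero L] (M : Fin d → ℕ) [hM : ∀ μ, NeZero (M μ)]

/-- **THE TOWER, geometric form**: along a COMP⁺ tower of unit transports over coherent unit taxi data with the scale-invariant plaquette class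
`(L^k·L)²·a_k ≤ c`, the relative phase against the straight taxi obeys `‖T_k x·conj (taxiT_k x) − 1‖ ≤ γ₀ + 4d²c·(1 − L^{−k})` (`L ≥ 2`). [folklore] -/
theorem tower_hrel_geom (hL : 2 ≤ L)
    {R' : (k : ℕ) → Tor (fine L (fine (L ^ k) M)) → Fin d → ℂ} (hR1 : ∀ k x μ, ‖R' k x μ‖ = 1)
    {a : ℕ → ℝ} (ha0 : ∀ k, 0 ≤ a k) (ha : ∀ k x κ ν, ‖plaq L (fine (L ^ k) M) (R' k) x κ ν - 1‖ ≤ a k)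
    {c : ℝ} (hclass : ∀ k, ((((L ^ k : ℕ) : ℝ)) * L) ^ 2 * a k ≤ c)
    (hcoh : ∀ k, coarseT L (fine (L ^ (k + 1)) M) (R' (k + 1)) = Rtr (L ^ k) L M (R' k))
    {T : (k : ℕ) → Tor (fine (L ^ k) M) → ℂ} (hT1 : ∀ k x, ‖T k x‖ = 1)
    (hTcomp : ∀ k, T (k + 1) = compT (L ^ k) L M (T k) (taxiT L (fine (L ^ k) M) (R' k)))
    {γ₀ : ℝ} (h0 : ∀ x, ‖T 0 x * conj (taxiT (L ^ 0) M (coarseT L (fine (L ^ 0) M) (R' 0)) x) - 1‖ ≤ γ₀) :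
    ∀ (k : ℕ) (x : Tor (fine (L ^ k) M)),
      ‖T k x * conj (taxiT (L ^ k) M (coarseT L (fine (L ^ k) M) (R' k)) x) - 1‖
        ≤ γ₀ + 4 * (d : ℝ) ^ 2 * c * (1 - (((L : ℝ) ^ k))⁻¹) := by
  have hL1 : (1 : ℝ) < L := by exact_mod_cast hL
  have hL0 : (0 : ℝ) < L := by linarith
  have hc0 : 0 ≤ c := le_trans (mul_nonneg (sq_nonneg _) (ha0 0)) (hclass 0)
  intro k
  induction k with
  | zero =>
    intro x
    simpa using h0 x
  | succ k ih =>
    intro x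
    have hn : 1 ≤ L ^ k := Nat.one_le_pow k L (Nat.pos_of_ne_zero (NeZero.ne L))
    -- the one-level step of part 1, at `n = L^k`, with the induction hypothesis as `hrel`
    have hstep := norm_compT_rel_step (L ^ k) L M (hR1 k) (ha k) (hT1 k) (γ := γ₀ + 4 * (d : ℝ) ^ 2 * c * (1 - ((L : ℝ) ^ k)⁻¹))
      (ih) x
    have hsc := step_le_of_class d (L ^ k) L hn (ha0 k) (hclass k)
    have e1 : (((L ^ k : ℕ) : ℝ)) = (L : ℝ) ^ k := by push_cast; ring
    rw [e1] at hsc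
    rw [hTcomp k, hcoh k]
    refine hstep.trans ?_
    -- geometric bookkeeping: `2d²c/L^k ≤ 4d²c·(L^{−k} − L^{−(k+1)})` for `L ≥ 2`
    have h2 : (L : ℝ)⁻¹ ≤ 1 / 2 := by
      rw [inv_le_comm₀ hL0 (by norm_num)]; norm_num; exact_mod_cast hL
    have hinv : 0 ≤ ((L : ℝ) ^ k)⁻¹ := by positivity
    have hD : 0 ≤ (d : ℝ) ^ 2 * c := by positivity
    have epow : ((L : ℝ) ^ (k + 1))⁻¹ = ((L : ℝ) ^ k)⁻¹ * (L : ℝ)⁻¹ := by rw [pow_succ, mul_inv]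
    have hkey : 2 * (d : ℝ) ^ 2 * c / (L : ℝ) ^ k ≤ 4 * (d : ℝ) ^ 2 * c * (((L : ℝ) ^ k)⁻¹ - ((L : ℝ) ^ (k + 1))⁻¹) := by
      rw [epow, div_eq_mul_inv]
      nlinarith [mul_nonneg (mul_nonneg hD hinv) (sub_nonneg.mpr h2)]
    linarith

/-- **THE TOWER** (R3's `hrel` binder for coherent taxi data, k-UNIFORM): `∀ k x, ‖T k x·conj (taxiT (L^k) M (coarseT L (fine (L^k) M) (R′ k)) x) − 1‖ ≤ γ₀ + 4d²·c`.
For the TAXI tower one takes `T 0 := taxiT 1 M (coarseT L (fine 1 M) (R′ 0))` (then `γ₀ = 0`) or `T 0 := 1`; smallness of `c` (and `γ₀`) makes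
`γ < 1` and `4γ² ≤ ½` as the END wants. [folklore] -/
theorem tower_hrel (hL : 2 ≤ L)
    {R' : (k : ℕ) → Tor (fine L (fine (L ^ k) M)) → Fin d → ℂ} (hR1 : ∀ k x μ, ‖R' k x μ‖ = 1)
    {a : ℕ → ℝ} (ha0 : ∀ k, 0 ≤ a k) (ha : ∀ k x κ ν, ‖plaq L (fine (L ^ k) M) (R' k) x κ ν - 1‖ ≤ a k)
    {c : ℝ} (hclass : ∀ k, ((((L ^ k : ℕ) : ℝ)) * L) ^ 2 * a k ≤ c)
    (hcoh : ∀ k, coarseT L (fine (L ^ (k + 1)) M) (R' (k + 1)) = Rtr (L ^ k) L M (R' k))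
    {T : (k : ℕ) → Tor (fine (L ^ k) M) → ℂ} (hT1 : ∀ k x, ‖T k x‖ = 1)
    (hTcomp : ∀ k, T (k + 1) = compT (L ^ k) L M (T k) (taxiT L (fine (L ^ k) M) (R' k)))
    {γ₀ : ℝ} (h0 : ∀ x, ‖T 0 x * conj (taxiT (L ^ 0) M (coarseT L (fine (L ^ 0) M) (R' 0)) x) - 1‖ ≤ γ₀) :
    ∀ (k : ℕ) (x : Tor (fine (L ^ k) M)),
      ‖T k x * conj (taxiT (L ^ k) M (coarseT L (fine (L ^ k) M) (R' k)) x) - 1‖ ≤ γ₀ + 4 * (d : ℝ) ^ 2 * c := by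
  intro k x
  have hc0 : 0 ≤ c := le_trans (mul_nonneg (sq_nonneg _) (ha0 0)) (hclass 0)
  have hL1 : (1 : ℝ) ≤ (L : ℝ) ^ k := by exact_mod_cast Nat.one_le_pow k L (Nat.pos_of_ne_zero (NeZero.ne L))
  refine (tower_hrel_geom L M hL hR1 ha0 ha hclass hcoh hT1 hTcomp h0 k x).trans ?_
  have hinv : 0 ≤ ((L : ℝ) ^ k)⁻¹ := by positivity
  nlinarith [mul_nonneg (by positivity : (0 : ℝ) ≤ 4 * (d : ℝ) ^ 2 * c) hinv]

end Summit.QuantumFields.BalabanUV.T4Continuum.VariationalTaxiNestedTower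

end
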